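import Mathlib
import Literature.Computability.AlgebraicComplexity.RazElusiveGeneralProofs
import Summits.ValiantsHypothesis.ValiantsHypothesis.Statement
import Summits.ValiantsHypothesis.ValiantsHypothesis.Theorems.SoloInformedQuadSpanReduction
import Summits.ValiantsHypothesis.ValiantsHypothesis.Theorems.SoloInformedQuadSpanClosed
import Summits.ValiantsHypothesis.ValiantsHypothesis.Theorems.SoloInformedWindowDesign
import HarnessLib

/-!
# The window form of Conjecture Q* implies `VP ℂ ≠ VNP ℂ`: orders growing like any power of
`log s`, arbitrary heights, all side conditions discharged
(solo seat `solo-ValiantsHypothesis-informed`, s28)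

`SoloInformedQuadSpanClosed` proves: if for ONE fixed order `K ≥ 2` and height `h ≥ 1` the
`(K, h)`-free exponent sets `E ⊂ ℕ` realised in the quadratic span of `s` algebraic functions
(`z^e ∈ span{1, b_j, b_j b_l}`, `b_1, …, b_s ∈ \overline{ℂ(z)}`) have `O(s^γ)` elements, `γ < 3/2`,
then `VP ℂ ≠ VNP ℂ` (Raz 2010, Cor. 5.8).  The seat's notes (`paper/quadspan.md`, Remark 2.9 (2′))
observe that the reduction only ever uses the bound at ONE value of `s` per input length `n`, with
a design whose order and height may grow with `n`; but in the kernel this "window" form was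
available only with hypotheses (`SoloInformedGrowingOrder`: Raz's side conditions and Def. 1.3
definability left open, the latter needing finite-field arithmetic for Reed–Solomon designs).

This file closes the window form with NO side hypotheses, using the Reed–Muller evaluation design
of `SoloInformedReedMullerDesign` (order `2^{d+1} - 1` from `(L+1)^d` positions, every height,
membership test a monomial in the index bits, hence Def. 1.3 with an empty Boolean sum):

* `soloInformed_vp_ne_vnp_of_windowBound_exponent` / `_rpow` and
  `soloInformed_valiantsHypothesis_of_windowBound` — let `Kf, hf : ℕ → ℕ` be any order and
  height functions with `Kf s ≥ 2`, `hf s ≥ 1` and `Kf s ≤ (⌊log₂ s⌋ + 2)^C` for large `s`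
  (some constant `C`).  IF for all large `s`, every `(Kf s, hf s)`-free exponent set realised in
  the quadratic span of `s` algebraic functions has at most `C' · s^γ` elements for some real
  `γ < 3/2`, THEN `VP ℂ ≠ VNP ℂ` (the summit constant `ValiantsHypothesis`).
* `soloInformed_valiantsHypothesis_of_logOrderBound` — the instance `Kf s = ⌊log₂ s⌋ + 2`
  ("(VB-log)" of the seat's notes, §7.19/§9.3): a bound `C' s^γ`, `γ < 3/2`, for the
  `(⌊log₂ s⌋ + 2, hf s)`-free realised sets, with ANY heights `hf s ≥ 1`, implies the summit.

Since freeness to a larger order or a larger height is a weaker requirement on `E`, the hypothesis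
here quantifies over FEWER sets than Conjecture Q* at any fixed `(K, h)`: the window form is the
weakest hypothesis of this family that the seat can certify to imply the summit.  (Known
unconditionally: `|E| ≤ 3s` at order `2s`, height `1` — `soloInformed_quadSpan_card_le_three_mul`;
the monomial baseline gives `(K, ∞)`-free realised sets of size `≍ s^{1 + 1/⌊K/2⌋}`, so at
growing order nothing below `s^{3/2}` is excluded by known examples, and nothing of the kind is
proved: the hypothesis is OPEN.)

Parameters and designs are those of `SoloInformedWindowDesign` (Reed–Muller design of degree
`d = ⌊log_{L+1} n⌋`, downgraded to order `Kf(s(n))`; singleton design where it does not fit).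
Credit: only the implication is claimed; its hypothesis is open (seat notes `paper/sharpest.md` §9).
References: R. Raz, Elusive functions and lower bounds for arithmetic circuits, Theory of
Computing 6 (2010) 135–177, Cor. 5.8 (= Cor. 1.14), Defs. 1.1, 1.3 [Raz2010].
-/

noncomputable section

open MvPolynomial Finset

namespace Summit.ValiantsHypothesis.ValiantsHypothesis.Theorems

open Literature.Computability.AlgebraicComplexity

/-! ### Freeness and realisation, and the pointwise elusiveness step -/

/-- `E ⊂ ℕ` is `(K, h)`-FREE: no integer relation `∑_{e ∈ E} c_e · e = 0` with at most `K`
nonzero coefficients, all of absolute value `≤ h`, other than the trivial one. -/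
def SoloNatFree (K h : ℕ) (E : Finset ℕ) : Prop :=
  ∀ c : ℕ → ℤ, (E.filter fun e => c e ≠ 0).card ≤ K → (∀ e, |c e| ≤ h) →
    (∑ e ∈ E, c e * (e : ℤ)) = 0 → ∀ e ∈ E, c e = 0

/-- `E` is REALISED in the quadratic span of the algebraic functions
`b_1, …, b_s ∈ \overline{ℂ(z)}`:
every `z^e`, `e ∈ E`, is a polynomial of total degree `≤ 2` in the `b_j`. -/
def SoloRealised {s : ℕ} (b : Fin s → SoloΩ) (E : Finset ℕ) : Prop :=
  ∀ e ∈ E, ∃ Γ : MvPolynomial (Fin s) ℂ, Γ.totalDegree ≤ 2 ∧ aeval b Γ = soloZ ^ e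

/-- Freeness is antitone in the order and the height: free to order `K'` and height `h'` implies
free to any order `K ≤ K'` and height `h ≤ h'`. -/
theorem SoloNatFree.mono {K K' h h' : ℕ} {E : Finset ℕ} (hE : SoloNatFree K' h' E) (hK : K ≤ K')
    (hh : h ≤ h') : SoloNatFree K h E :=
  fun c hc hch hsum => hE c (hc.trans hK) (fun e => (hch e).trans (by exact_mod_cast hh)) hsum

/-- **Pointwise elusiveness step.**  For a `(K, h)`-design `S` of `m` sets (`K ≥ 2`, `h ≥ 1`): if
every `(K, h)`-free exponent set realised in the quadratic span of `s` algebraic functions has fewer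
than `m` elements, the monomial map of `S` is `(s, 2)`-elusive (Raz 2010, Def. 1.1).  (Same proof
as `soloInformed_isElusive_designMap`, with the bound used at the single value `s`.)
[cite: Raz2010, Def. 1.1] -/
theorem soloInformed_isElusive_designMap_of_bound {K h m n s : ℕ} (hK : 2 ≤ K) (hh : 1 ≤ h)
    (S : SoloDesign K h m n)
    (hQ : ∀ (b : Fin s → SoloΩ) (E : Finset ℕ), SoloNatFree K h E → SoloRealised b E → E.card < m) :
    IsElusive (soloDesignMap S.S) s 2 := by
  classical
  by_contra hne
  have hg : ¬ IsElusive (fun i => (X 0 : MvPolynomial (Fin 1) ℂ) ^ soloExp K h S.S i) s 2 := by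
    intro hg
    apply hne
    intro Γ hΓ hsub
    exact hg Γ hΓ ((solo_range_pow_subset S.S).trans hsub)
  obtain ⟨Γ, b, hΓ, hb⟩ := exists_aeval_eq_X_pow_of_not_isElusive (soloExp K h S.S) hg
  have hcard : (univ.image (soloExp K h S.S)).card = m := by
    rw [Finset.card_image_of_injective _ (solo_exp_injective S hK hh), Finset.card_univ,
      Fintype.card_fin]
  have hspan : SoloRealised b (univ.image (soloExp K h S.S)) := by
    intro e he
    obtain ⟨i, -, rfl⟩ := Finset.mem_image.1 he
    exact ⟨Γ i, hΓ i, by rw [soloZ]; exact (hb i).symm⟩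
  have := hQ b _ (solo_free_image S hK hh) hspan
  omega

/-- **The growing-order reduction, pointwise form.**  Orders `K n ≥ 2`, heights `h n ≥ 1`, designs
`S n : SoloDesign (K n) (h n) (C(n + r n - 1, r n)) n`; Raz's side conditions on `r, s`; the bound
"every `(K n, h n)`-free set realised by `s n` algebraic functions has fewer than
`C(n + r n - 1, r n)` elements" eventually; and Def. 1.3 definability of the design maps —
give `VP ℂ ≠ VNP ℂ` by Raz 2010, Cor. 5.8 (tree theorem `Raz2010_cor_5_8_holds`).
[cite: Raz2010, Cor. 5.8 = Cor. 1.14] -/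
theorem soloInformed_vp_ne_vnp_of_window_pointwise (K h : ℕ → ℕ)
    (hK : ∀ n, 2 ≤ K n) (hh : ∀ n, 1 ≤ h n) {r s : ℕ → ℕ}
    (S : ∀ n, SoloDesign (K n) (h n) (Nat.choose (n + r n - 1) (r n)) n)
    (hpar : ∃ n₀ : ℕ, ∀ n ≥ n₀, 3 ≤ r n ∧ r n ≤ n ∧ n ≤ s n)
    (hgrow : ∀ c : ℕ, ∃ n₀ : ℕ, ∀ n ≥ n₀,
      n ^ c * Nat.choose (n + 2 * r n / 3 - 1) (2 * r n / 3) ≤ s n)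
    (hQm : ∃ n₀ : ℕ, ∀ n ≥ n₀, ∀ (b : Fin (s n) → SoloΩ) (E : Finset ℕ),
      SoloNatFree (K n) (h n) E → SoloRealised b E → E.card < Nat.choose (n + r n - 1) (r n))
    (hdef : IsPolyDefinableMap (m := fun n => Nat.choose (n + r n - 1) (r n))
      (σ := fun n => Fin n) fun n => soloDesignMap (S n).S) :
    VP ℂ ≠ VNP ℂ := by
  refine perNotPComputableComplex_iff_holds.mp ?_
  have hel : ∃ n₀ : ℕ, ∀ n ≥ n₀, ∃ (G : Type) (_ : Field G) (_ : Algebra ℂ G),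
      IsElusive (fun i => MvPolynomial.map (algebraMap ℂ G) (soloDesignMap (S n).S i))
        (s n) 2 := by
    obtain ⟨n₀, h0⟩ := hQm
    refine ⟨n₀, fun n hn => ⟨ℂ, inferInstance, inferInstance, ?_⟩⟩
    have hid : (fun i => MvPolynomial.map (algebraMap ℂ ℂ) (soloDesignMap (S n).S i))
        = soloDesignMap (S n).S := by
      funext i
      rw [Algebra.algebraMap_self, MvPolynomial.map_id]
    rw [hid]
    exact soloInformed_isElusive_designMap_of_bound (hK n) (hh n) (S n) (h0 n hn)
  exact Raz2010_cor_5_8_holds ℂ ringChar_complex_ne_two r s (fun n => soloDesignMap (S n).S)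
    hpar hgrow hdef hel


/-! ### The window form of Conjecture Q* implies the summit -/

/-- **Window form, exponent version.**  Let `Kf, hf : ℕ → ℕ` with `Kf s ≥ 2`, `hf s ≥ 1`, and
`Kf s ≤ (⌊log₂ s⌋ + 2)^C` for `s ≥ s₁`.  If for all `s ≥ s₀` every `(Kf s, hf s)`-free exponent set
`E` realised in the quadratic span of `s` algebraic functions satisfies `|E|^b ≤ c · s^a`, where
`2a < 3b`, then `VP ℂ ≠ VNP ℂ`.  Designs, parameters and the Def. 1.3 witness are the explicit ones
of this file; Raz 2010, Cor. 5.8 enters through `soloInformed_vp_ne_vnp_of_window_pointwise`.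
[cite: Raz2010, Cor. 5.8 = Cor. 1.14, Defs. 1.1, 1.3] -/
theorem soloInformed_vp_ne_vnp_of_windowBound_exponent (Kf hf : ℕ → ℕ) (hK : ∀ s, 2 ≤ Kf s)
    (hh : ∀ s, 1 ≤ hf s) {Cexp s₁ : ℕ} (hKf : ∀ s, s₁ ≤ s → Kf s ≤ (Nat.log 2 s + 2) ^ Cexp)
    {a b c s₀ : ℕ} (hab : 2 * a < 3 * b)
    (hQ : ∀ s : ℕ, s₀ ≤ s → ∀ (g : Fin s → SoloΩ) (E : Finset ℕ),
      SoloNatFree (Kf s) (hf s) E → SoloRealised g E → E.card ^ b ≤ c * s ^ a) :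
    VP ℂ ≠ VNP ℂ := by
  obtain ⟨n₀, hn₀⟩ := qw_eventually a b c Kf hKf
  refine soloInformed_vp_ne_vnp_of_window_pointwise (fun n => Kf (qwS a b c n))
    (fun n => hf (qwS a b c n)) (fun n => hK _) (fun n => hh _) (r := qwR a b c Kf)
    (s := qwS a b c) (qwDesign a b c Kf hf) ?_ ?_ ?_ (qw_isPolyDefinableMap a b c Kf hf)
  · refine ⟨n₀, fun n hn => ?_⟩ -- Raz's parameter conditions `3 ≤ r ≤ n ≤ s`
    obtain ⟨hn1, hf, hW⟩ := hn₀ n hn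
    have hr : qwR a b c Kf n = 3 * qwRho a b c n := if_pos hf
    have hWge := qwW_ge a b c (qwTau a b c n)
    have hρ : qwRho a b c n = a * qwTau a b c n + 1 := rfl
    refine ⟨?_, ?_, ?_⟩
    · rw [hr, hρ]; omega
    · rw [hr, hρ]; exact hWge.2.1.trans (hW.trans (Nat.log_le_self 2 n))
    · exact Nat.le_self_pow (by rw [hρ]; omega) n
  · intro c₀ -- growth: `n^{c₀} · C(n + 2ρ - 1, 2ρ) ≤ n^{c₀ + 2ρ} ≤ n^{2ρ + τ} = s`
    refine ⟨max n₀ (2 ^ qwW a b c c₀), fun n hn => ?_⟩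
    obtain ⟨hn1, hf, -⟩ := hn₀ n ((le_max_left _ _).trans hn)
    have hr : qwR a b c Kf n = 3 * qwRho a b c n := if_pos hf
    have hτ : c₀ ≤ qwTau a b c n :=
      le_qwTau a b c (Nat.le_log_of_pow_le one_lt_two ((le_max_right _ _).trans hn))
    rw [hr, show 2 * (3 * qwRho a b c n) / 3 = 2 * qwRho a b c n by omega]
    unfold qwS
    calc n ^ c₀ * Nat.choose (n + 2 * qwRho a b c n - 1) (2 * qwRho a b c n)
        ≤ n ^ c₀ * n ^ (2 * qwRho a b c n) :=
          Nat.mul_le_mul_left _ (choose_multiset_le_pow hn1 _)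
      _ = n ^ (c₀ + 2 * qwRho a b c n) := (pow_add _ _ _).symm
      _ ≤ n ^ (2 * qwRho a b c n + qwTau a b c n) := Nat.pow_le_pow_right hn1 (by omega)
  · -- the bound beats the arity: every free realised `E` has `|E| < C(n + r - 1, r)`
    refine ⟨max n₀ s₀, fun n hn g E hfree hreal => ?_⟩
    obtain ⟨hn1, hf, hW⟩ := hn₀ n ((le_max_left _ _).trans hn)
    have hr : qwR a b c Kf n = 3 * qwRho a b c n := if_pos hf
    have hWge := qwW_ge a b c (qwTau a b c n)
    have hlog : Nat.log 2 n < n := Nat.log_lt_self 2 (by omega)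
    have hs₀ : s₀ ≤ qwS a b c n :=
      ((le_max_right _ _).trans hn).trans (Nat.le_self_pow (by unfold qwRho; omega) n)
    have hQ' := hQ _ hs₀ g E hfree hreal
    revert hQ'
    rw [hr]; unfold qwS qwRho; set τ := qwTau a b c n with hτdef
    intro hQ'
    obtain ⟨d₁, hd₁⟩ : ∃ d₁, 3 * b = 2 * a + 1 + d₁ := ⟨3 * b - (2 * a + 1), by omega⟩
    have hident : (2 * (a * τ + 1) + τ) * a + (a * τ * d₁ + d₁ + 1) = 3 * (a * τ + 1) * b := by
      rw [show 3 * (a * τ + 1) * b = (a * τ + 1) * (3 * b) by ring, hd₁]; ring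
    by_contra hle; push Not at hle
    have h1 : n ^ (3 * (a * τ + 1)) ≤
        Nat.factorial (3 * (a * τ + 1)) * Nat.choose (n + 3 * (a * τ + 1) - 1) (3 * (a * τ + 1)) :=
      solo_pow_le_factorial_mul_choose_multiset n _
    have h2 : n ^ (3 * (a * τ + 1) * b) ≤
        Nat.factorial (3 * (a * τ + 1)) ^ b * (c * (n ^ (2 * (a * τ + 1) + τ)) ^ a) :=
      calc n ^ (3 * (a * τ + 1) * b) = (n ^ (3 * (a * τ + 1))) ^ b := pow_mul _ _ _
        _ ≤ (Nat.factorial (3 * (a * τ + 1)) *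
              Nat.choose (n + 3 * (a * τ + 1) - 1) (3 * (a * τ + 1))) ^ b :=
            Nat.pow_le_pow_left h1 _
        _ = Nat.factorial (3 * (a * τ + 1)) ^ b *
              Nat.choose (n + 3 * (a * τ + 1) - 1) (3 * (a * τ + 1)) ^ b := mul_pow _ _ _
        _ ≤ Nat.factorial (3 * (a * τ + 1)) ^ b * E.card ^ b :=
            Nat.mul_le_mul_left _ (Nat.pow_le_pow_left hle _)
        _ ≤ Nat.factorial (3 * (a * τ + 1)) ^ b * (c * (n ^ (2 * (a * τ + 1) + τ)) ^ a) :=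
            Nat.mul_le_mul_left _ hQ'
    have h3 : n ^ ((2 * (a * τ + 1) + τ) * a) * n ≤ n ^ (3 * (a * τ + 1) * b) := by
      rw [← hident, pow_add]; exact Nat.mul_le_mul_left _ (Nat.le_self_pow (by omega) n)
    have h4 : n ^ ((2 * (a * τ + 1) + τ) * a) * n ≤
        n ^ ((2 * (a * τ + 1) + τ) * a) * (Nat.factorial (3 * (a * τ + 1)) ^ b * c) :=
      calc n ^ ((2 * (a * τ + 1) + τ) * a) * n ≤ n ^ (3 * (a * τ + 1) * b) := h3
        _ ≤ Nat.factorial (3 * (a * τ + 1)) ^ b * (c * (n ^ (2 * (a * τ + 1) + τ)) ^ a) := h2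
        _ = n ^ ((2 * (a * τ + 1) + τ) * a) * (Nat.factorial (3 * (a * τ + 1)) ^ b * c) := by
            rw [← pow_mul]; ring
    have h5 : n ≤ Nat.factorial (3 * (a * τ + 1)) ^ b * c :=
      Nat.le_of_mul_le_mul_left h4 (by positivity)
    have h6 : c * Nat.factorial (3 * (a * τ + 1)) ^ b < n :=
      lt_of_le_of_lt (hWge.2.2.2.trans hW) hlog
    linarith [h5, h6]

/-- **Window form, real-exponent version**: a bound `|E| ≤ C' · s^γ` with a real `γ < 3/2` for the
`(Kf s, hf s)`-free realised sets, `s ≥ s₀`, with `2 ≤ Kf s ≤ (⌊log₂ s⌋ + 2)^C` eventually and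
`hf s ≥ 1`, implies `VP ℂ ≠ VNP ℂ`. [cite: Raz2010, Cor. 5.8 = Cor. 1.14] -/
theorem soloInformed_vp_ne_vnp_of_windowBound_rpow (Kf hf : ℕ → ℕ) (hK : ∀ s, 2 ≤ Kf s)
    (hh : ∀ s, 1 ≤ hf s) {Cexp s₁ : ℕ} (hKf : ∀ s, s₁ ≤ s → Kf s ≤ (Nat.log 2 s + 2) ^ Cexp)
    {γ C : ℝ} (hγ : γ < 3 / 2) {s₀ : ℕ}
    (hQ : ∀ s : ℕ, s₀ ≤ s → ∀ (g : Fin s → SoloΩ) (E : Finset ℕ),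
      SoloNatFree (Kf s) (hf s) E → SoloRealised g E → (E.card : ℝ) ≤ C * (s : ℝ) ^ γ) :
    VP ℂ ≠ VNP ℂ := by
  set γ' := max γ 0 with hγ' -- exponents `a / b` with `γ' ≤ a / b` and `2a < 3b`
  have hγ'0 : 0 ≤ γ' := le_max_right _ _
  have hγ'lt : γ' < 3 / 2 := max_lt hγ (by norm_num)
  have hpos : 0 < 3 - 2 * γ' := by linarith
  obtain ⟨b, hb⟩ := exists_nat_gt (2 / (3 - 2 * γ'))
  have hb2 : 2 < (b : ℝ) * (3 - 2 * γ') := (div_lt_iff₀ hpos).1 hb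
  have hb0r : (0 : ℝ) < b := lt_trans (by positivity) hb
  have hb0 : 0 < b := by exact_mod_cast hb0r
  set a := ⌈γ' * b⌉₊ with ha
  have ha1 : γ' * b ≤ a := Nat.le_ceil _
  have ha2 : (a : ℝ) < γ' * b + 1 := Nat.ceil_lt_add_one (by positivity)
  have hab : 2 * a < 3 * b := by exact_mod_cast (by linarith : (2 * a : ℝ) < 3 * b)
  set C' := max C 0 with hC'
  have hC'0 : 0 ≤ C' := le_max_right _ _
  refine soloInformed_vp_ne_vnp_of_windowBound_exponent Kf hf hK hh hKf (a := a) (b := b)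
    (c := ⌈C' ^ b⌉₊) (s₀ := max s₀ 1) hab fun s hs g E hfree hreal => ?_
  have hs1 : (1 : ℝ) ≤ s := by exact_mod_cast (le_max_right _ _).trans hs
  have hs0 : (0 : ℝ) ≤ s := by positivity
  have hγab : γ ≤ (a : ℝ) / b :=
    calc γ ≤ γ' := le_max_left _ _
      _ ≤ (a : ℝ) / b := by rw [le_div_iff₀ hb0r]; exact ha1
  have h1 : (E.card : ℝ) ≤ C' * (s : ℝ) ^ ((a : ℝ) / b) :=
    calc (E.card : ℝ) ≤ C * (s : ℝ) ^ γ := hQ s ((le_max_left _ _).trans hs) g E hfree hreal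
      _ ≤ C' * (s : ℝ) ^ γ := mul_le_mul_of_nonneg_right (le_max_left _ _) (by positivity)
      _ ≤ C' * (s : ℝ) ^ ((a : ℝ) / b) :=
          mul_le_mul_of_nonneg_left (Real.rpow_le_rpow_of_exponent_le hs1 hγab) hC'0
  have h2 : ((E.card : ℝ)) ^ b ≤ C' ^ b * (s : ℝ) ^ a :=
    calc ((E.card : ℝ)) ^ b ≤ (C' * (s : ℝ) ^ ((a : ℝ) / b)) ^ b :=
          pow_le_pow_left₀ (by positivity) h1 b
      _ = C' ^ b * ((s : ℝ) ^ ((a : ℝ) / b)) ^ b := mul_pow _ _ _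
      _ = C' ^ b * (s : ℝ) ^ a := by
          congr 1
          rw [← Real.rpow_natCast ((s : ℝ) ^ ((a : ℝ) / b)) b, ← Real.rpow_mul hs0,
            div_mul_cancel₀ (a : ℝ) hb0r.ne', Real.rpow_natCast]
  have h3 : ((E.card ^ b : ℕ) : ℝ) ≤ ((⌈C' ^ b⌉₊ * s ^ a : ℕ) : ℝ) := by
    push_cast
    calc ((E.card : ℝ)) ^ b ≤ C' ^ b * (s : ℝ) ^ a := h2
      _ ≤ (⌈C' ^ b⌉₊ : ℝ) * (s : ℝ) ^ a :=
          mul_le_mul_of_nonneg_right (Nat.le_ceil _) (by positivity)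
  exact_mod_cast h3

/-- **Window form of Conjecture Q* ⟹ Valiant's hypothesis** (the summit constant).  Orders
`2 ≤ Kf s ≤ (⌊log₂ s⌋ + 2)^C` (eventually), heights `hf s ≥ 1` arbitrary: if for all large `s`
every `(Kf s, hf s)`-free exponent set realised in the quadratic span of `s` algebraic functions has
at most `C' · s^γ` elements, `γ < 3/2` real, then `ValiantsHypothesis`.  This is the implication
only; its hypothesis is open. [cite: Raz2010, Cor. 5.8 = Cor. 1.14] -/
theorem soloInformed_valiantsHypothesis_of_windowBound (Kf hf : ℕ → ℕ) (hK : ∀ s, 2 ≤ Kf s)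
    (hh : ∀ s, 1 ≤ hf s) {Cexp s₁ : ℕ} (hKf : ∀ s, s₁ ≤ s → Kf s ≤ (Nat.log 2 s + 2) ^ Cexp)
    {γ C : ℝ} (hγ : γ < 3 / 2) {s₀ : ℕ}
    (hQ : ∀ s : ℕ, s₀ ≤ s → ∀ (g : Fin s → SoloΩ) (E : Finset ℕ),
      SoloNatFree (Kf s) (hf s) E → SoloRealised g E → (E.card : ℝ) ≤ C * (s : ℝ) ^ γ) :
    ValiantsHypothesis :=
  soloInformed_vp_ne_vnp_of_windowBound_rpow Kf hf hK hh hKf hγ hQ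

/-- **(VB-log) ⟹ Valiant's hypothesis.**  If for some real `γ < 3/2`, some `C` and SOME height
function `hf ≥ 1`, for all large `s` every exponent set `E ⊂ ℕ` that is free to order
`⌊log₂ s⌋ + 2` and height `hf s` and realised in the quadratic span of `s` algebraic functions has
`|E| ≤ C · s^γ`, then `VP ℂ ≠ VNP ℂ`.  (Known: `|E| = O(s)` at order `2s`; the monomial examples,
free to every order, have `|E| = s^{1+o(1)}` at growing order; the hypothesis is open.)
[cite: Raz2010, Cor. 5.8 = Cor. 1.14] -/
theorem soloInformed_valiantsHypothesis_of_logOrderBound (hf : ℕ → ℕ) (hh : ∀ s, 1 ≤ hf s)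
    {γ C : ℝ} (hγ : γ < 3 / 2) {s₀ : ℕ}
    (hQ : ∀ s : ℕ, s₀ ≤ s → ∀ (g : Fin s → SoloΩ) (E : Finset ℕ),
      SoloNatFree (Nat.log 2 s + 2) (hf s) E → SoloRealised g E → (E.card : ℝ) ≤ C * (s : ℝ) ^ γ) :
    ValiantsHypothesis :=
  soloInformed_valiantsHypothesis_of_windowBound (fun s => Nat.log 2 s + 2) hf (fun _ => by omega)
    hh (Cexp := 1) (s₁ := 0) (fun s _ => by rw [pow_one]) hγ hQ

/-- **Polylogarithmic order.**  The same with order `(⌊log₂ s⌋ + 2)^C` for any fixed `C ≥ 1`: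
a bound `C' s^γ`, `γ < 3/2`, on the `((⌊log₂ s⌋ + 2)^C, hf s)`-free realised sets implies the
summit. [cite: Raz2010, Cor. 5.8 = Cor. 1.14] -/
theorem soloInformed_valiantsHypothesis_of_polylogOrderBound (Cexp : ℕ) (hC : 1 ≤ Cexp)
    (hf : ℕ → ℕ) (hh : ∀ s, 1 ≤ hf s) {γ C : ℝ} (hγ : γ < 3 / 2) {s₀ : ℕ}
    (hQ : ∀ s : ℕ, s₀ ≤ s → ∀ (g : Fin s → SoloΩ) (E : Finset ℕ),
      SoloNatFree ((Nat.log 2 s + 2) ^ Cexp) (hf s) E → SoloRealised g E →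
        (E.card : ℝ) ≤ C * (s : ℝ) ^ γ) :
    ValiantsHypothesis := by
  refine soloInformed_valiantsHypothesis_of_windowBound (fun s => (Nat.log 2 s + 2) ^ Cexp) hf
    (fun s => ?_) hh (Cexp := Cexp) (s₁ := 0) (fun s _ => le_rfl) hγ hQ
  calc 2 ≤ (Nat.log 2 s + 2) ^ 1 := by rw [pow_one]; omega
    _ ≤ (Nat.log 2 s + 2) ^ Cexp := Nat.pow_le_pow_right (by omega) hC

/-- **Fixed order is a special case**: the closed form of `SoloInformedQuadSpanClosed` (one order
`K ≥ 2`, one height `h ≥ 1`) follows from the window form with the constant functions, since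
`K ≤ 2^K ≤ (⌊log₂ s⌋ + 2)^K`. [cite: Raz2010, Cor. 5.8 = Cor. 1.14] -/
theorem soloInformed_valiantsHypothesis_of_fixedOrderBound (K h : ℕ) (hK : 2 ≤ K) (hh : 1 ≤ h)
    {γ C : ℝ} (hγ : γ < 3 / 2) {s₀ : ℕ}
    (hQ : ∀ s : ℕ, s₀ ≤ s → ∀ (g : Fin s → SoloΩ) (E : Finset ℕ),
      SoloNatFree K h E → SoloRealised g E → (E.card : ℝ) ≤ C * (s : ℝ) ^ γ) :
    ValiantsHypothesis := by
  refine soloInformed_valiantsHypothesis_of_windowBound (fun _ => K) (fun _ => h) (fun _ => hK)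
    (fun _ => hh) (Cexp := K) (s₁ := 0) (fun s _ => ?_) hγ hQ
  calc K ≤ 2 ^ K := Nat.lt_two_pow_self.le
    _ ≤ (Nat.log 2 s + 2) ^ K := Nat.pow_le_pow_left (by omega) K

end Summit.ValiantsHypothesis.ValiantsHypothesis.Theorems

end
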